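import Mathlib
import Literature.NumberTheory.LFunctions.Zhang2022.Section17Phi3minusSizes
import HarnessLib

/-!
# Zhang (2022) §17 (17.8): the support of `(bχ)∗ν₁*` below `PT⁻²`, the `l = D⁴` boundary term of
# `ϱ*`, and the segment→line error — inputs of the assembly of `Eq17_8Chi`

Topic `Literature/NumberTheory/LFunctions/Zhang2022` (Landau–Siegel audit tree; verdict-neutral).
Y. Zhang, *Discrete mean estimates and the Landau–Siegel zero*, arXiv:2211.02515v1 (2022)
[Zhang2022LandauSiegel] — **an unrefereed manuscript under adjudication; nothing here asserts or
denies its Theorems 1–2.** §17 p. 98: "Note that the arithmetic function `(b∗ν₁*)(n)` is supported on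
`n < PT⁻²`. In a way similar to the proof of (17.3) we deduce that `Φ₃⁻(p) = pΣ_n (b∗ν₁*)(n)ϱ*(n)/n
+ o(p)`" ((17.8); χ-twisted reading `Typed.Section17.Eq17_8Chi`). Fourth file of the (17.8)χ
discharge:

* `bchiConv_eq_zero_of_le` — `((bχ)∗ν₁*)(n) = 0` for `n ≥ PT⁻²` once `𝓛 ≥ 5¹⁰` (the twisted twin of
  the tree's `Typed.Section17.bConvNuOne_eq_zero_of_le`; `bχ` has the support of `b`);
* `varrhoLe_sub_varrho17` — `ϱ*_≤(n) − ϱ*(n) = [D⁴ ∣ n]·ν(D⁴)κ̄₂(n/D⁴)`: the `≤ D⁴` reading of u017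
  (which is what `𝔨₃*` produces, `step17_u017_le_holds`) and the PRINTED `ϱ*` (`l < D⁴`,
  `varrho17`) differ by the single boundary term `l = D⁴`;
* `exp_segment_error_le_P_inv_sq` — `e^{(1−𝓛₁²)/(4𝓛₂²)} ≤ P⁻²` for `𝓛 ≥ 12`.

Theorems only, 0 defs, no (A).

## References

* Y. Zhang, arXiv:2211.02515v1 (2022), §17 p. 98 ((17.8)); §15 (15.2); §6 p. 12.
  [cite: Zhang2022LandauSiegel, §17 (17.8) p. 98]
-/
noncomputable section

open Complex Real ComplexConjugate Finset

namespace Literature.NumberTheory.LFunctions.Zhang2022.Phi3Minus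

open Literature.NumberTheory.LFunctions.Zhang2022
open Literature.NumberTheory.LFunctions.Zhang2022.Skeleton
open Literature.NumberTheory.LFunctions.Zhang2022.Typed.Section17
open scoped LSeries.notation

section Support

variable (c' : ℝ) {D : ℕ} (χ : DirichletCharacter ℂ D)

/-- A Dirichlet convolution (as an antidiagonal sum) of two sequences vanishing from `A` resp. `B`
on vanishes from `A·B` on. [folklore] -/
private theorem sum_antidiagonal_eq_zero_of_support {u v : ℕ → ℂ} {A B : ℝ}
    (hu : ∀ a : ℕ, A ≤ (a : ℝ) → u a = 0) (hv : ∀ b : ℕ, B ≤ (b : ℝ) → v b = 0) {n : ℕ}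
    (hn : A * B ≤ (n : ℝ)) : ∑ q ∈ n.divisorsAntidiagonal, u q.1 * v q.2 = 0 := by
  refine Finset.sum_eq_zero fun q hq => ?_
  have hqn : (q.1 : ℝ) * q.2 = n := by exact_mod_cast (Nat.mem_divisorsAntidiagonal.mp hq).1
  by_cases ha : A ≤ (q.1 : ℝ)
  · rw [hu _ ha, zero_mul]
  · by_cases hb : B ≤ (q.2 : ℝ)
    · rw [hv _ hb, mul_zero]
    · exfalso
      have hlt : (q.1 : ℝ) * q.2 < A * B :=
        mul_lt_mul'' (not_le.mp ha) (not_le.mp hb) (Nat.cast_nonneg _) (Nat.cast_nonneg _)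
      linarith

/-- `LSeries.convolution` version of `sum_antidiagonal_eq_zero_of_support`. [folklore] -/
private theorem convolution_eq_zero_of_support {u v : ℕ → ℂ} {A B : ℝ}
    (hu : ∀ a : ℕ, A ≤ (a : ℝ) → u a = 0) (hv : ∀ b : ℕ, B ≤ (b : ℝ) → v b = 0) {n : ℕ}
    (hn : A * B ≤ (n : ℝ)) : LSeries.convolution u v n = 0 := by
  rw [LSeries.convolution_def]
  exact sum_antidiagonal_eq_zero_of_support hu hv hn


/-- `5𝓛 ≤ 𝓛^{1.1}` once `𝓛 ≥ 5¹⁰` (`𝓛^{1.1} = 𝓛^{0.1}·𝓛`, `𝓛^{0.1} ≥ 5`). [cite: Zhang2022LandauSiegel, §6 p.12 (`T = exp 𝓛^{1.1}`)] -/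
private theorem five_mul_ell_le (hℓ : (5 : ℝ) ^ (10 : ℕ) ≤ ell D) : 5 * ell D ≤ ell D ^ (1.1 : ℝ) := by
  have hℓ0 : 0 < ell D := lt_of_lt_of_le (by positivity) hℓ
  have e1 : ((5 : ℝ) ^ (10 : ℕ)) ^ (0.1 : ℝ) = 5 := by
    rw [← Real.rpow_natCast, ← Real.rpow_mul (by norm_num : (0 : ℝ) ≤ 5)]
    norm_num
  have h5 : (5 : ℝ) ≤ ell D ^ (0.1 : ℝ) := by
    rw [← e1]
    exact Real.rpow_le_rpow (by positivity) hℓ (by norm_num)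
  have hsplit : ell D ^ (1.1 : ℝ) = ell D ^ (0.1 : ℝ) * ell D := by
    rw [show (1.1 : ℝ) = 0.1 + 1 by norm_num, Real.rpow_add hℓ0, Real.rpow_one]
  rw [hsplit]
  exact mul_le_mul_of_nonneg_right h5 hℓ0.le

/-- **`4(D⁴+1) ≤ T`** once `𝓛 ≥ 5¹⁰`: `4(D⁴+1) ≤ 8D⁴ = 8e^{4𝓛} ≤ e^{5𝓛} ≤ e^{𝓛^{1.1}} = T`.
[cite: Zhang2022LandauSiegel, §6 p.12 (`T = exp 𝓛^{1.1}`)] -/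
private theorem four_mul_pow_four_succ_le_bigT (hℓ : (5 : ℝ) ^ (10 : ℕ) ≤ ell D) :
    4 * ((D : ℝ) ^ 4 + 1) ≤ bigT D := by
  have hℓ0 : 0 < ell D := lt_of_lt_of_le (by positivity) hℓ
  have hD0 : (0 : ℝ) < D := by
    rcases Nat.eq_zero_or_pos D with h | h
    · exfalso; simp [ell, h] at hℓ0
    · exact_mod_cast h
  have hD1 : (1 : ℝ) ≤ (D : ℝ) ^ 4 := by
    have h1 : (1 : ℝ) ≤ D := by
      by_contra h
      have : Real.log D ≤ 0 := Real.log_nonpos hD0.le (not_le.mp h).le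
      exact absurd this (not_le.mpr hℓ0)
    exact one_le_pow₀ h1
  have hexp : (D : ℝ) ^ 4 = Real.exp (4 * ell D) := by
    rw [ell, show (4 : ℝ) * Real.log D = ((4 : ℕ) : ℝ) * Real.log D by norm_num, Real.exp_nat_mul,
      Real.exp_log hD0]
  have h8 : (8 : ℝ) ≤ Real.exp (ell D) := by
    have := Real.add_one_le_exp (ell D)
    have h7 : (7 : ℝ) ≤ ell D := le_trans (by norm_num) hℓ
    linarith
  calc 4 * ((D : ℝ) ^ 4 + 1) ≤ 8 * (D : ℝ) ^ 4 := by linarith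
    _ = 8 * Real.exp (4 * ell D) := by rw [hexp]
    _ ≤ Real.exp (ell D) * Real.exp (4 * ell D) :=
        mul_le_mul_of_nonneg_right h8 (Real.exp_pos _).le
    _ = Real.exp (5 * ell D) := by rw [← Real.exp_add]; ring_nf
    _ ≤ bigT D := by
        rw [bigT, Real.exp_le_exp]
        exact five_mul_ell_le hℓ


/-- **`max(P₂,P₃)·T⁹ ≤ P^{1/2}`** once `𝓛 ≥ 5¹⁰` (`P₂T⁹ = P^{1/2}T⁻¹`; `P₃T⁹ = P^{0.498}e^{9𝓛^{1.1}} ≤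
P^{0.498}P^{0.002}` since `9𝓛^{1.1} ≤ 0.002𝓛⁹`). [cite: Zhang2022LandauSiegel, §2 (2.21), §6 p.12] -/
private theorem max_P2_P3_mul_bigT_pow_le (hℓ : (5 : ℝ) ^ (10 : ℕ) ≤ ell D) :
    max (Skeleton.P2 D) (Skeleton.P3 D) * bigT D ^ 9 ≤ bigP D ^ (1 / 2 : ℝ) := by
  have hℓ1 : 1 ≤ ell D := le_trans (by norm_num) hℓ
  have hℓ0 : 0 < ell D := by linarith
  have hP : 0 < bigP D := Real.exp_pos _
  have hT0 : 0 < bigT D := Real.exp_pos _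
  have hT1 : 1 ≤ bigT D := Real.one_le_exp (by positivity)
  rw [max_mul_of_nonneg _ _ (pow_nonneg hT0.le 9)]
  refine max_le ?_ ?_
  · -- `P₂ T⁹ = P^{1/2} / T ≤ P^{1/2}`
    rw [Skeleton.P2, show (0.5 : ℝ) = 1 / 2 by norm_num]
    have : bigP D ^ (1 / 2 : ℝ) / bigT D ^ 10 * bigT D ^ 9 = bigP D ^ (1 / 2 : ℝ) / bigT D := by
      field_simp
    rw [this]
    exact div_le_self (Real.rpow_nonneg hP.le _) hT1
  · -- `P₃ T⁹ ≤ P^{0.498} P^{0.002} = P^{1/2}`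
    have h11 : ell D ^ (1.1 : ℝ) ≤ ell D ^ 2 := by
      have := Real.rpow_le_rpow_of_exponent_le hℓ1 (show (1.1 : ℝ) ≤ 2 by norm_num)
      rwa [Real.rpow_two] at this
    have h7 : (4500 : ℝ) ≤ ell D ^ 7 := by
      have h4500 : (4500 : ℝ) ≤ ell D := le_trans (by norm_num) hℓ
      calc (4500 : ℝ) ≤ ell D := h4500
        _ = ell D ^ 1 := (pow_one _).symm
        _ ≤ ell D ^ 7 := pow_le_pow_right₀ hℓ1 (by norm_num)
    have key : 9 * ell D ^ (1.1 : ℝ) ≤ 0.002 * ell D ^ 9 := by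
      have h2 : 0 ≤ ell D ^ 2 := by positivity
      calc 9 * ell D ^ (1.1 : ℝ) ≤ 9 * ell D ^ 2 := by linarith
        _ = 0.002 * (4500 * ell D ^ 2) := by ring
        _ ≤ 0.002 * (ell D ^ 7 * ell D ^ 2) := by gcongr
        _ = 0.002 * ell D ^ 9 := by ring
    have hT9 : bigT D ^ 9 = Real.exp (9 * ell D ^ (1.1 : ℝ)) := by
      rw [bigT, ← Real.exp_nat_mul]; norm_num
    have hP002 : bigP D ^ (0.002 : ℝ) = Real.exp (0.002 * ell D ^ 9) := by
      rw [bigP, ← Real.exp_mul]; ring_nf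
    calc Skeleton.P3 D * bigT D ^ 9 ≤ Skeleton.P3 D * bigP D ^ (0.002 : ℝ) := by
          refine mul_le_mul_of_nonneg_left ?_ (Real.rpow_nonneg hP.le _)
          rw [hT9, hP002, Real.exp_le_exp]
          exact key
      _ = bigP D ^ (1 / 2 : ℝ) := by
          rw [Skeleton.P3, ← Real.rpow_add hP]; norm_num


/-- **`((bχ)∗ν₁*)(n) = 0` for `n ≥ PT⁻²`** once `𝓛 ≥ 5¹⁰` (the inline claim before (17.8), χ-twisted
reading): `bχ` vanishes from `P^{1/2}max(P₂,P₃) ≤ PT⁻⁹` on, `ν₁*` from `4(D⁴+1)T⁴ ≤ T⁵` on, and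
`PT⁻⁹·T⁵ ≤ PT⁻²`. [cite: Zhang2022LandauSiegel, §17 (17.8) p.98] -/
theorem bchiConv_eq_zero_of_le (hℓ : (5 : ℝ) ^ (10 : ℕ) ≤ ell D) {n : ℕ}
    (hn : bigP D / bigT D ^ 2 ≤ (n : ℝ)) :
    ((fun n => bcoef D n * χ (n : ZMod D)) ⍟ nuOneStar c' χ) n = 0 := by
  have hP : 0 < bigP D := Real.exp_pos _
  have hT0 : 0 < bigT D := Real.exp_pos _
  have hT1 : 1 ≤ bigT D := Real.one_le_exp (by unfold ell; positivity)
  have hsqrt : bigP D ^ (1 / 2 : ℝ) * bigP D ^ (1 / 2 : ℝ) = bigP D := by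
    rw [← Real.rpow_add hP]; norm_num
  have hmax : max (Skeleton.P2 D) (Skeleton.P3 D) ≤ bigP D ^ (1 / 2 : ℝ) / bigT D ^ 9 := by
    rw [le_div_iff₀ (pow_pos hT0 9)]; exact max_P2_P3_mul_bigT_pow_le hℓ
  have hS1 := four_mul_pow_four_succ_le_bigT hℓ
  refine convolution_eq_zero_of_support
    (fun a ha => by rw [bcoef_eq_zero_of_sqrtP_mul_max_le ha, zero_mul])
    (fun b hb => nuOneStar_eq_zero_of_le c' χ hb) (le_trans ?_ hn)
  calc bigP D ^ (1 / 2 : ℝ) * max (Skeleton.P2 D) (Skeleton.P3 D) * (4 * ((D : ℝ) ^ 4 + 1) * bigT D ^ 4)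
      ≤ bigP D ^ (1 / 2 : ℝ) * (bigP D ^ (1 / 2 : ℝ) / bigT D ^ 9) * (bigT D * bigT D ^ 4) := by
        refine mul_le_mul (mul_le_mul_of_nonneg_left hmax (Real.rpow_nonneg hP.le _))
          (mul_le_mul_of_nonneg_right hS1 (by positivity)) (by positivity) ?_
        exact mul_nonneg (Real.rpow_nonneg hP.le _) (div_nonneg (Real.rpow_nonneg hP.le _) (by positivity))
    _ = (bigP D ^ (1 / 2 : ℝ) * bigP D ^ (1 / 2 : ℝ)) * (bigT D ^ 5 / bigT D ^ 9) := by ring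
    _ = bigP D * (bigT D ^ 5 / bigT D ^ 9) := by rw [hsqrt]
    _ ≤ bigP D * (1 / bigT D ^ 2) := by
        refine mul_le_mul_of_nonneg_left ?_ hP.le
        rw [div_le_div_iff₀ (pow_pos hT0 9) (pow_pos hT0 2), one_mul]
        calc bigT D ^ 5 * bigT D ^ 2 = bigT D ^ 7 := by ring
          _ ≤ bigT D ^ 9 := pow_le_pow_right₀ hT1 (by norm_num)
    _ = bigP D / bigT D ^ 2 := by ring

end Support

/-! ## The boundary term `l = D⁴` -/

section Boundary

variable (c' : ℝ) {D : ℕ} (χ : DirichletCharacter ℂ D)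

/-- **`ϱ*_≤(n) − ϱ*(n) = [D⁴ ∣ n]·ν(D⁴)·κ̄₂(n/D⁴)`** (`D ≥ 1`): the two truncations `l ≤ D⁴` / `l < D⁴`
of `ν` differ only at `l = D⁴`. [cite: Zhang2022LandauSiegel, §17 u017–u018 p.97–98] -/
theorem varrhoLe_sub_varrho17 (hD : D ≠ 0) (n : ℕ) :
    (trunc (D ^ 4) (nu χ) ⍟ kappa2bar c' D) n - varrho17 c' χ n =
      if D ^ 4 ∣ n then nu χ (D ^ 4) * kappa2bar c' D (n / D ^ 4) else 0 := by
  have hD4 : D ^ 4 ≠ 0 := pow_ne_zero 4 hD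
  rw [varrho17, LSeries.convolution_def, LSeries.convolution_def, ← Finset.sum_sub_distrib]
  have hterm : ∀ q ∈ n.divisorsAntidiagonal,
      trunc (D ^ 4) (nu χ) q.1 * kappa2bar c' D q.2 -
          (if q.1 < D ^ 4 then nu χ q.1 else 0) * kappa2bar c' D q.2 =
        if q.1 = D ^ 4 then nu χ (D ^ 4) * kappa2bar c' D q.2 else 0 := by
    intro q _
    simp only [trunc]
    rcases lt_trichotomy q.1 (D ^ 4) with h | h | h
    · rw [if_pos h.le, if_pos h, if_neg h.ne, sub_self]
    · rw [if_pos h.le, if_neg (by rw [h]; exact lt_irrefl _), if_pos h, h, zero_mul, sub_zero]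
    · rw [if_neg (not_le.mpr h), if_neg (not_lt.mpr h.le), if_neg h.ne', zero_mul, sub_self]
  rw [Finset.sum_congr rfl hterm, Finset.sum_ite, Finset.sum_const_zero, add_zero]
  by_cases hdvd : D ^ 4 ∣ n
  · rw [if_pos hdvd]
    rcases eq_or_ne n 0 with rfl | hn
    · simp [kappa2bar]
    have hmem : ∀ q ∈ n.divisorsAntidiagonal, q.1 = D ^ 4 ↔ q = (D ^ 4, n / D ^ 4) := by
      intro q hq
      have hqn := (Nat.mem_divisorsAntidiagonal.mp hq).1
      constructor
      · intro h1
        have h2 : q.2 = n / D ^ 4 := by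
          rw [← hqn, h1, Nat.mul_div_cancel_left _ (Nat.pos_of_ne_zero hD4)]
        exact Prod.ext h1 h2
      · intro h; rw [h]
    have hfilter : n.divisorsAntidiagonal.filter (fun q => q.1 = D ^ 4) = {(D ^ 4, n / D ^ 4)} := by
      ext q
      simp only [Finset.mem_filter, Finset.mem_singleton]
      constructor
      · rintro ⟨hq, h1⟩; exact (hmem q hq).mp h1
      · intro h
        refine ⟨?_, by rw [h]⟩
        rw [h, Nat.mem_divisorsAntidiagonal]
        exact ⟨Nat.mul_div_cancel' hdvd, hn⟩
    rw [hfilter, Finset.sum_singleton]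
  · rw [if_neg hdvd]
    refine Finset.sum_eq_zero fun q hq => ?_
    exfalso
    obtain ⟨hq, h1⟩ := Finset.mem_filter.mp hq
    exact hdvd ⟨q.2, by rw [← h1]; exact ((Nat.mem_divisorsAntidiagonal.mp hq).1).symm⟩

end Boundary

/-! ## The segment→line error -/

/-- **`e^{(1−𝓛₁²)/(4𝓛₂²)} ≤ P⁻²`** for `𝓛 ≥ 12` (`𝓛₁ = 𝓛⁴⁰⁵`, `𝓛₂ = 𝓛⁴⁰⁰`, `P = e^{𝓛⁹}`:
`(1−𝓛₁²)/(4𝓛₂²) ≤ 1 − 𝓛^{10}/4 ≤ −2𝓛⁹`). [cite: Zhang2022LandauSiegel, §17 (17.3), (17.8)] -/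
theorem exp_segment_error_le_P_inv_sq {D : ℕ} (hℓ : 12 ≤ ell D) :
    Real.exp ((1 - ell1 D ^ 2) / (4 * ell2 D ^ 2)) ≤ (bigP D ^ 2)⁻¹ := by
  have hℓ1 : 1 ≤ ell D := le_trans (by norm_num) hℓ
  have hℓ0 : 0 < ell D := by linarith
  have h2 : 0 < ell2 D := pow_pos hℓ0 _
  rw [bigP, ← Real.exp_nat_mul, ← Real.exp_neg, Real.exp_le_exp]
  -- `ℓ₁² = ℓ^{810} = ℓ^{10}·ℓ₂²`
  have e1 : ell1 D ^ 2 = ell D ^ 10 * ell2 D ^ 2 := by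
    rw [ell1, ell2]; ring
  rw [div_le_iff₀ (by positivity), e1]
  -- goal: `1 − ℓ^{10}ℓ₂² ≤ −(2ℓ⁹)·(4ℓ₂²)`, i.e. `1 + 8ℓ⁹ℓ₂² ≤ ℓ^{10}ℓ₂²`
  have h9 : 8 * ell D ^ 9 + 1 ≤ ell D ^ 10 := by
    have h22 : 1 ≤ ell2 D ^ 2 := one_le_pow₀ (one_le_pow₀ hℓ1)
    have : ell D ^ 10 = ell D * ell D ^ 9 := by ring
    have h9' : 1 ≤ ell D ^ 9 := one_le_pow₀ hℓ1
    nlinarith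
  have h22 : 1 ≤ ell2 D ^ 2 := one_le_pow₀ (one_le_pow₀ hℓ1)
  push_cast
  nlinarith [pow_nonneg hℓ0.le 9]

end Literature.NumberTheory.LFunctions.Zhang2022.Phi3Minus
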